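import Summits.CriticalPhenomena.PercolationContinuityZ3.Theorems.PercNearOneGluingNoHeavyQuantSliceSingleLow
import Summits.CriticalPhenomena.PercolationContinuityZ3.Theorems.PercNearOneGluingNoHeavyQuantSliceSingleLowCaseTwo
import Summits.CriticalPhenomena.PercolationContinuityZ3.Theorems.PercNearOneGluingNoHeavyQuantSliceSmallLayers
import Summits.CriticalPhenomena.PercolationContinuityZ3.Theorems.PercNearOneGluingNoHeavyQuantLawDecFlowsDecomposition
import HarnessLib

/-!
# QUANT lane R8, T-DEC: SL for SINGLE-LOW laws at the DEC level — `DEC(T, j′) ∧ DEC(T, λ) ⟹ slice DEC(T+ag, j′)` in Case 1 and for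
# `g ≥ 1/2` (LEAD-NOTES-G22 N48 (2)–(3): the conjecture SL-λ* for single-low laws, two of three cases)

builds on p205010 (kernel theorem, internal audit signed; external expert review pending)

Support file (`--supports stmt-CriticalPhenomena-4575`), QUANT lane typer seat prim-quant-stmt (gen 23), rung R8 of
`run/shared/lean/prim/quant/LADDER.md`.  Theorems only; standard axioms, no sorries.  Wrappers: lead g22's `low_capacity_of_decAtT` /
`low_giantCapacity_of_decAtT` (p305864) feed `slice_flowAtT_singleLow_case1` (…QuantSliceSingleLow) and `slice_flowAtT_singleLow_case2_half`
(…QuantSliceSingleLowCaseTwo); typer g22's `decAtT_of_flowAtT` converts the witness into `DECAtT`.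
* `slice_decAtT_singleLow_case1`, `slice_decAtT_singleLow_case2_half`, **`slice_decAtT_singleLow_of_half`** (the two cases together: every
  single-low law in the frame with a gate `g ≥ 1/2` satisfies SL-λ).  Frame: probability law `ν` on `{0..M}`; only low `l` at `(T, j′)`,
  deep, `l + a ≤ j′ ≤ M`; `λ ≤ j′`, `j′ ≤ λ + a`, no band atom above `λ`, every charged mid `≤ λ` incompatible with `l` (with `λ = λ*` these are
  lead g22's geometry lemma N48 (1)).  OPEN: Case 2 with `g < 1/2`.

[this work].  Nothing here is cited as a published result.  The gluing rows served [cite: KozmaNitzan2024, Conjecture 3 (p. 15)]; product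
measure [cite: Grimmett1999, §1.3 p. 10].
-/

noncomputable section

namespace Summit.CriticalPhenomena.PercolationContinuityZ3.Theorems

namespace Quant

open Finset

namespace LawDec

/-- **SL FOR SINGLE-LOW LAWS AT THE DEC LEVEL, CASE 1**: for a probability law `ν` on `{0..M}` (single low `l`, deep, `l + a ≤ j′ ≤ M`,
blob `(a ≥ 1, x ≤ g ≤ 1)`), a second layer `λ ≤ j′` with `j′ ≤ λ + a`, no band atom above `λ` and every charged mid `h ≤ λ`
incompatible with `l` (`l + h ≤ T`): **`DECAtT x T j′ M ν ∧ DECAtT x T λ M ν ⟹ DECAtT x (T+ag) j′ (M+a) (slice ν a g)`** in Case 1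
(`Σ A_h ≤ g·ν l`).  The two DEC hypotheses enter only through lead g22's capacity inequalities. [this work] -/
theorem slice_decAtT_singleLow_case1 (x T g : ℝ) (j' M l a lam : ℕ) (ν : ℕ → ℝ) (hx0 : 0 < x) (hx1 : x < 1) (hxg : x ≤ g)
    (hg1 : g ≤ 1) (ha : 1 ≤ a) (hν : ∀ k, 0 ≤ ν k) (hνM : ∀ k, M < k → ν k = 0)
    (hν1 : ∑ h ∈ Finset.range (M + 1), ν h = 1) (hjM : j' ≤ M)
    (hlaj : l + a ≤ j') (hlow : 2 * (l : ℝ) < T) (hdeep : 2 * ((l : ℝ) + a) < T + (a : ℝ) * g)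
    (hsingle : ∀ k, k ≤ j' → 2 * (k : ℝ) < T → k ≠ l → ν k = 0)
    (hlam : j' ≤ lam + a) (hlamj : lam ≤ j') (hnoband : ∀ h, lam < h → h ≤ j' → 0 < ν h → T + (a : ℝ) * g ≤ 2 * (h : ℝ))
    (hincomp : ∀ h, h ≤ lam → T ≤ 2 * (h : ℝ) → 0 < ν h → (l : ℝ) + h ≤ T)
    (hdecj : DECAtT x T j' M ν) (hdeclam : DECAtT x T lam M ν)
    (hcase1 : ∑ h ∈ Finset.range (M + a + 1),
        (if h ≤ j' ∧ T ≤ 2 * (h : ℝ) ∧ T < (l : ℝ) + h then (1 - g) * ν h / usage x (T + (a : ℝ) * g) j' (l + a) h else 0)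
      ≤ g * ν l) :
    DECAtT x (T + (a : ℝ) * g) j' (M + a) (slice ν a g) := by
  have hCj := low_capacity_of_decAtT x T j' M l ν hx0 hx1 hν hdecj (by omega) hlow
  have hClam := low_giantCapacity_of_decAtT x T lam M l ν hx0 hx1 hν hdeclam (by omega) (by omega) hlow hincomp
  exact decAtT_of_flowAtT x (T + (a : ℝ) * g) j' (M + a) (slice ν a g) hx0 hx1 (slice_eq_zero ν a g M hνM)
    (sum_slice ν a g M hνM hν1)
    (slice_flowAtT_singleLow_case1 x T g j' M l a lam ν hx0 hx1 hxg hg1 ha hν hνM hjM hlaj hlow hdeep hsingle hlam hnoband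
      hCj hClam hcase1)

/-- **SL FOR SINGLE-LOW LAWS AT THE DEC LEVEL, CASE 2 with `g ≥ 1/2`**: same frame; only `DECAtT x T λ M ν` is used. [this work] -/
theorem slice_decAtT_singleLow_case2_half (x T g : ℝ) (j' M l a lam : ℕ) (ν : ℕ → ℝ) (hx0 : 0 < x) (hx1 : x < 1) (hxg : x ≤ g)
    (hg1 : g ≤ 1) (ha : 1 ≤ a) (hν : ∀ k, 0 ≤ ν k) (hνM : ∀ k, M < k → ν k = 0)
    (hν1 : ∑ h ∈ Finset.range (M + 1), ν h = 1) (hjM : j' ≤ M)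
    (hlaj : l + a ≤ j') (hlow : 2 * (l : ℝ) < T) (hdeep : 2 * ((l : ℝ) + a) < T + (a : ℝ) * g)
    (hsingle : ∀ k, k ≤ j' → 2 * (k : ℝ) < T → k ≠ l → ν k = 0)
    (hlam : j' ≤ lam + a) (hlamj : lam ≤ j') (hnoband : ∀ h, lam < h → h ≤ j' → 0 < ν h → T + (a : ℝ) * g ≤ 2 * (h : ℝ))
    (hincomp : ∀ h, h ≤ lam → T ≤ 2 * (h : ℝ) → 0 < ν h → (l : ℝ) + h ≤ T)
    (hdeclam : DECAtT x T lam M ν) (hhalf : 1 - g ≤ g)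
    (hcase2 : g * ν l < ∑ h ∈ Finset.range (M + a + 1),
        (if h ≤ j' ∧ T ≤ 2 * (h : ℝ) ∧ T < (l : ℝ) + h then (1 - g) * ν h / usage x (T + (a : ℝ) * g) j' (l + a) h else 0)) :
    DECAtT x (T + (a : ℝ) * g) j' (M + a) (slice ν a g) := by
  have hClam := low_giantCapacity_of_decAtT x T lam M l ν hx0 hx1 hν hdeclam (by omega) (by omega) hlow hincomp
  exact decAtT_of_flowAtT x (T + (a : ℝ) * g) j' (M + a) (slice ν a g) hx0 hx1 (slice_eq_zero ν a g M hνM)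
    (sum_slice ν a g M hνM hν1)
    (slice_flowAtT_singleLow_case2_half x T g j' M l a lam ν hx0 hx1 hxg hg1 ha hν hνM hjM hlaj hlow hdeep hsingle hlam hnoband
      hClam hhalf hcase2)

/-- **both cases with `g ≥ 1/2` together**: SL-λ for single-low laws and gates `g ≥ 1/2` (resp. every gate in Case 1). [this work] -/
theorem slice_decAtT_singleLow_of_half (x T g : ℝ) (j' M l a lam : ℕ) (ν : ℕ → ℝ) (hx0 : 0 < x) (hx1 : x < 1) (hxg : x ≤ g)
    (hg1 : g ≤ 1) (ha : 1 ≤ a) (hν : ∀ k, 0 ≤ ν k) (hνM : ∀ k, M < k → ν k = 0)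
    (hν1 : ∑ h ∈ Finset.range (M + 1), ν h = 1) (hjM : j' ≤ M)
    (hlaj : l + a ≤ j') (hlow : 2 * (l : ℝ) < T) (hdeep : 2 * ((l : ℝ) + a) < T + (a : ℝ) * g)
    (hsingle : ∀ k, k ≤ j' → 2 * (k : ℝ) < T → k ≠ l → ν k = 0)
    (hlam : j' ≤ lam + a) (hlamj : lam ≤ j') (hnoband : ∀ h, lam < h → h ≤ j' → 0 < ν h → T + (a : ℝ) * g ≤ 2 * (h : ℝ))
    (hincomp : ∀ h, h ≤ lam → T ≤ 2 * (h : ℝ) → 0 < ν h → (l : ℝ) + h ≤ T)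
    (hdecj : DECAtT x T j' M ν) (hdeclam : DECAtT x T lam M ν) (hhalf : 1 - g ≤ g) :
    DECAtT x (T + (a : ℝ) * g) j' (M + a) (slice ν a g) := by
  by_cases hcase : ∑ h ∈ Finset.range (M + a + 1),
      (if h ≤ j' ∧ T ≤ 2 * (h : ℝ) ∧ T < (l : ℝ) + h then (1 - g) * ν h / usage x (T + (a : ℝ) * g) j' (l + a) h else 0) ≤ g * ν l
  · exact slice_decAtT_singleLow_case1 x T g j' M l a lam ν hx0 hx1 hxg hg1 ha hν hνM hν1 hjM hlaj hlow hdeep hsingle hlam hlamj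
      hnoband hincomp hdecj hdeclam hcase
  · exact slice_decAtT_singleLow_case2_half x T g j' M l a lam ν hx0 hx1 hxg hg1 ha hν hνM hν1 hjM hlaj hlow hdeep hsingle hlam hlamj
      hnoband hincomp hdeclam hhalf (not_le.1 hcase)

end LawDec

end Quant

end Summit.CriticalPhenomena.PercolationContinuityZ3.Theorems
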